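import Mathlib
import Literature.Probability.RandomPlanarGeometry.CurveClassStopAtMeasurable
import Literature.Probability.RandomPlanarGeometry.StopAtThickening
import HarnessLib

/-!
# Announcing the hitting time of a closed set on path space (soft-Markov brick P1a)

Crux `AxiomsOfLimit` (stmt-CriticalPhenomena-1370), line `registered`, stub `stub_markovOfLimit`,
soft-Markov brick P1a "announcing the hitting time on path space" (lead c4). Theorems only.

On the path space `C([0,1], ℂ)` with the canonical filtration `𝔽 t = σ(path stopped at t)`
(stopped path `ω ↦ ω ∘ (id ⊓ const (projIcc t))`), for a closed `F`, a finite measure `μ` and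
`ε > 0` we construct (`stub_announcingOnPathSpace`) rational-valued increasing stopping times
`σ n ≤ 1` and an event `B` such that on `B` the `σ n` are `< τ_F` (the hitting parameter of `F`)
and converge to `τ_F`, `B` lies both in `σ(path stopped at τ_F)` and in `⨆ n, 𝔽_{σ n}`, every
`σ n` is a Borel function of the path stopped at `τ_F`, and
`μ ({start ∉ F, the path meets F} \ B) ≤ ε`.

Construction: `τ_k` = hitting parameter of the closed thickening `F_k = cthickening (1/(k+1)) F`
(a stopping time, `< τ_F` on `{start ∉ F, meets F}`, `→ τ_F`); `ρ_k = ⌈2^{m_k} τ_k⌉ / 2^{m_k}`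
(dyadic upper approximations: stopping times with countable range), the levels `m_k` chosen by
continuity from above of `μ` so that `μ {τ_k < τ_F ≤ τ_k + 2^{-m_k}} ≤ ε 2^{-k-1}`;
`σ n = max_{k ≤ n} ρ_k` and `B = ⋂ k, {ρ_k < τ_F}`.

Folklore: announceable (predictable) stopping times, C. Dellacherie, P.-A. Meyer,
*Probabilités et potentiel*, Ch. IV. All `[folklore]`.
-/

noncomputable section

open MeasureTheory Filter Topology Set Metric
open scoped ENNReal

namespace Summit.CriticalPhenomena.SAWScalingLimit.Theorems.AxiomsOfLimitMarkov

open Literature.Probability.RandomPlanarGeometry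

/-- The path `ω` stopped at real time `t`: `u ↦ ω (min u (projIcc t))`. [folklore] -/
local notation3 "stp[" t ", " ω "]" =>
  ContinuousMap.comp ω (ContinuousMap.id unitInterval ⊓
    ContinuousMap.const unitInterval (Set.projIcc (0:ℝ) 1 zero_le_one t))

/-- The hitting parameter of `F` by the path `ω`. [folklore] -/
local notation3 "hit[" F ", " ω "]" => Curve.hitParam F (Curve.mk ω)

/-! ### Hitting parameters of stopped paths -/

/-- Stopping a path can only delay the hitting of a set. [folklore] -/
theorem hit_le_hit_stp (F : Set ℂ) (t : ℝ) (ω : C(unitInterval, ℂ)) :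
    hit[F, ω] ≤ hit[F, stp[t, ω]] := by
  refine le_csInf ⟨1, Curve.one_mem_hitSet _ _⟩ ?_
  rintro s (⟨hs, hmem⟩ | hs)
  · exact (Curve.hitParam_le (γ := Curve.mk ω)
      (t := ⟨s, hs⟩ ⊓ Set.projIcc (0:ℝ) 1 zero_le_one t) hmem).trans
      (Subtype.coe_le_coe.2 (min_le_left (⟨s, hs⟩ : unitInterval) _))
  · rw [mem_singleton_iff.1 hs]
    exact (Curve.hitParam_mem_Icc _ _).2

/-- A path that meets the closed set `F` no later than (the clamped) `t` has the same hitting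
parameter as its stopped version. [folklore] -/
theorem hit_stp_eq {F : Set ℂ} (hF : IsClosed F) {t : ℝ} {ω : C(unitInterval, ℂ)}
    (h : hit[F, ω] ≤ (Set.projIcc (0:ℝ) 1 zero_le_one t : ℝ)) : hit[F, stp[t, ω]] = hit[F, ω] := by
  refine le_antisymm ?_ (hit_le_hit_stp F t ω)
  by_cases hex : ∃ u, (Curve.mk ω) u ∈ F
  · have hq := Curve.apply_hitParam_mem hF hex
    refine Curve.hitParam_le (γ := Curve.mk (stp[t, ω]))
      (t := ⟨hit[F, ω], Curve.hitParam_mem_Icc _ _⟩) ?_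
    have hle : (⟨hit[F, ω], Curve.hitParam_mem_Icc _ _⟩ : unitInterval) ≤
        Set.projIcc 0 1 zero_le_one t := h
    show ω (min ⟨hit[F, ω], Curve.hitParam_mem_Icc _ _⟩ (Set.projIcc 0 1 zero_le_one t)) ∈ F
    rwa [min_eq_left hle]
  · push Not at hex
    rw [Curve.hitParam_eq_one_of_forall_notMem hex]
    exact (Curve.hitParam_mem_Icc _ _).2

/-- A path stopped strictly before it meets `F` never meets `F`. [folklore] -/
theorem hit_stp_of_lt {F : Set ℂ} {t : ℝ} {ω : C(unitInterval, ℂ)}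
    (h : (Set.projIcc (0:ℝ) 1 zero_le_one t : ℝ) < hit[F, ω]) : hit[F, stp[t, ω]] = 1 :=
  Curve.hitParam_eq_one_of_forall_notMem fun u =>
    Curve.notMem_of_lt_hitParam (γ := Curve.mk ω) (t := u ⊓ Set.projIcc 0 1 zero_le_one t)
      (lt_of_le_of_lt (Subtype.coe_le_coe.2 inf_le_right) h)

/-- **Key measurability fact**: `{τ_F ≤ s}` is determined by the path stopped at `s`. [folklore] -/
theorem hit_stp_le_iff {F : Set ℂ} (hF : IsClosed F) (s : ℝ) (ω : C(unitInterval, ℂ)) :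
    hit[F, stp[s, ω]] ≤ s ↔ hit[F, ω] ≤ s := by
  rcases le_or_gt (hit[F, ω]) (Set.projIcc (0:ℝ) 1 zero_le_one s : ℝ) with h | h
  · rw [hit_stp_eq hF h]
  · rw [hit_stp_of_lt h]
    have h1 := h.trans_le (Curve.hitParam_mem_Icc F (Curve.mk ω)).2
    have hs : s < 1 := lt_of_not_ge fun hs => by
      rw [Set.projIcc_of_right_le _ hs] at h1
      exact lt_irrefl _ h1
    have hs' : s ≤ (Set.projIcc (0:ℝ) 1 zero_le_one s : ℝ) := by
      rw [Set.coe_projIcc]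
      exact le_max_of_le_right (le_min hs.le le_rfl)
    exact iff_of_false (not_le.2 hs) (not_le.2 (hs'.trans_lt h))

/-- The path stopped at `τ_F` has the same hitting parameter of any closed `F' ⊇ F`. [folklore] -/
theorem hit_stp_hit {F F' : Set ℂ} (hF' : IsClosed F') (h : F ⊆ F') (ω : C(unitInterval, ℂ)) :
    hit[F', stp[hit[F, ω], ω]] = hit[F', ω] :=
  hit_stp_eq hF' (by
    rw [Set.projIcc_of_mem _ (Curve.hitParam_mem_Icc F (Curve.mk ω))]
    exact Curve.hitParam_mono h _)

/-- On `{start ∉ F, the path meets F}` the closed thickenings of `F` are met strictly before `F`.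
[folklore] -/
theorem hit_cthickening_lt {F : Set ℂ} (hF : IsClosed F) {r : ℝ} (hr : 0 < r)
    {ω : C(unitInterval, ℂ)} (h0 : ω 0 ∉ F) (hh : ∃ t, ω t ∈ F) :
    hit[cthickening r F, ω] < hit[F, ω] := by
  refine (Curve.hitParam_mono (self_subset_cthickening F) (Curve.mk ω)).lt_of_ne fun heq => ?_
  set q : unitInterval := ⟨hit[F, ω], Curve.hitParam_mem_Icc _ _⟩ with hq
  have hqF : ω q ∈ F := Curve.apply_hitParam_mem hF hh
  have hq0 : (0 : unitInterval) < q :=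
    lt_of_le_of_ne (show (0:ℝ) ≤ hit[F, ω] from (Curve.hitParam_mem_Icc _ _).1)
      fun h => h0 (by rw [h]; exact hqF)
  obtain ⟨l, hl, hlq⟩ := exists_Ioc_subset_of_mem_nhds
    ((isOpen_thickening.preimage ω.continuous).mem_nhds (self_subset_thickening hr F hqF))
    ⟨0, hq0⟩
  obtain ⟨u, hlu, huq⟩ := exists_between hl
  exact Curve.notMem_of_lt_hitParam (γ := Curve.mk ω) (F := cthickening r F) (t := u)
    (by rw [heq]; exact huq) (thickening_subset_cthickening r F (hlq ⟨hlu, huq.le⟩))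

/-! ### Dyadic upper approximations -/

/-- `x ≤ ⌈2^m x⌉ / 2^m`. [folklore] -/
theorem le_ceil_div (x : ℝ) (m : ℕ) : x ≤ (⌈x * 2 ^ m⌉ : ℝ) / 2 ^ m := by
  rw [le_div_iff₀ (by positivity)]; exact Int.le_ceil _

/-- `⌈2^m x⌉ / 2^m ≤ x + 2^{-m}`. [folklore] -/
theorem ceil_div_le_add (x : ℝ) (m : ℕ) : (⌈x * 2 ^ m⌉ : ℝ) / 2 ^ m ≤ x + 1 / 2 ^ m := by
  have h : (0:ℝ) < 2 ^ m := by positivity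
  rw [div_le_iff₀ h, add_mul, one_div_mul_cancel h.ne']
  exact (Int.ceil_lt_add_one _).le

/-- `⌈2^m x⌉ / 2^m ≤ 1` for `x ≤ 1`. [folklore] -/
theorem ceil_div_le_one {x : ℝ} (hx : x ≤ 1) (m : ℕ) : (⌈x * 2 ^ m⌉ : ℝ) / 2 ^ m ≤ 1 := by
  rw [div_le_iff₀ (by positivity), one_mul]
  have h1 : ⌈x * 2 ^ m⌉ ≤ (2 ^ m : ℤ) :=
    Int.ceil_le.2 (by exact_mod_cast mul_le_of_le_one_left (by positivity) hx)
  exact_mod_cast h1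

/-- `⌈2^m x⌉ / 2^m ≤ t ↔ x ≤ ⌊2^m t⌋ / 2^m` (ceiling / floor Galois connections). [folklore] -/
theorem ceil_div_le_iff (x t : ℝ) (m : ℕ) :
    (⌈x * 2 ^ m⌉ : ℝ) / 2 ^ m ≤ t ↔ x ≤ (⌊t * 2 ^ m⌋ : ℝ) / 2 ^ m := by
  rw [div_le_iff₀ (by positivity), le_div_iff₀ (by positivity), ← Int.le_floor, Int.ceil_le]

/-- `⌈2^m x⌉ / 2^m` is (the cast of) a rational number. [folklore] -/
theorem ceil_div_mem_range (x : ℝ) (m : ℕ) :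
    (⌈x * 2 ^ m⌉ : ℝ) / 2 ^ m ∈ Set.range (fun q : ℚ => (q : ℝ)) :=
  ⟨(⌈x * 2 ^ m⌉ : ℚ) / 2 ^ m, by push_cast; rfl⟩

/-- For real-valued stopping times `ρ`, `τ` with `ρ` of countable range, `{ρ < τ} ∈ 𝔽_ρ`
(decompose along the values of `ρ`). [folklore] -/
theorem measurableSet_lt_stoppingTime {Ω : Type*} {mΩ : MeasurableSpace Ω}
    {𝔽 : Filtration ℝ mΩ} {ρ τ : Ω → ℝ} (hρ : IsStoppingTime 𝔽 fun ω => ((ρ ω : ℝ) : WithTop ℝ))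
    (hc : (Set.range ρ).Countable) (hτ : IsStoppingTime 𝔽 fun ω => ((τ ω : ℝ) : WithTop ℝ)) :
    MeasurableSet[hρ.measurableSpace] {ω | ρ ω < τ ω} := by
  have hc' : (Set.range fun ω => ((ρ ω : ℝ) : WithTop ℝ)).Countable := by
    rw [show (fun ω => ((ρ ω : ℝ) : WithTop ℝ)) = (fun r : ℝ => (r : WithTop ℝ)) ∘ ρ from rfl,
      Set.range_comp]
    exact hc.image _
  have hset : {ω | ρ ω < τ ω} =
      ⋃ d ∈ Set.range ρ, {ω | ((d : ℝ) : WithTop ℝ) < τ ω} ∩ {ω | ((ρ ω : ℝ) : WithTop ℝ) = d} := by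
    ext ω
    simp only [Set.mem_iUnion, Set.mem_inter_iff, Set.mem_setOf_eq, WithTop.coe_lt_coe,
      WithTop.coe_eq_coe, exists_prop, Set.mem_range]
    exact ⟨fun h => ⟨ρ ω, ⟨ω, rfl⟩, h, rfl⟩, fun ⟨d, _, hd, he⟩ => by rw [he]; exact hd⟩
  rw [hset]
  refine MeasurableSet.biUnion hc fun d _ => ?_
  rw [hρ.measurableSet_inter_eq_iff]
  exact (hτ.measurableSet_gt d).inter (hρ.measurableSet_eq_of_countable_range hc' d)

section Measurable

variable [MeasurableSpace C(unitInterval, ℂ)] [BorelSpace C(unitInterval, ℂ)]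

/-- The hitting parameter of a closed set is a stopping time of the canonical filtration of path
space. [folklore] -/
theorem isStoppingTime_hit {F : Set ℂ} (hF : IsClosed F)
    (𝔽 : Filtration ℝ (inferInstance : MeasurableSpace C(unitInterval, ℂ)))
    (h𝔽 : ∀ t : ℝ,
      𝔽 t = MeasurableSpace.comap (fun ω : C(unitInterval, ℂ) => stp[t, ω]) inferInstance) :
    IsStoppingTime 𝔽 fun ω => ((hit[F, ω] : ℝ) : WithTop ℝ) := by
  intro s
  rw [h𝔽 s, MeasurableSpace.measurableSet_comap]
  refine ⟨{ω | hit[F, ω] ≤ s}, measurableSet_le (Curve.measurable_hitParam_mk hF) measurable_const,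
    ?_⟩
  ext ω
  simp only [Set.mem_preimage, Set.mem_setOf_eq, WithTop.coe_le_coe]
  exact hit_stp_le_iff hF s ω

/-- The dyadic upper approximation `⌈2^m τ_{F}⌉ / 2^m` of the hitting parameter of a closed set is
a stopping time: `{⌈2^m τ⌉ / 2^m ≤ t} = {τ ≤ ⌊2^m t⌋ / 2^m}` and `⌊2^m t⌋ / 2^m ≤ t`. [folklore] -/
theorem isStoppingTime_ceil_hit {F : Set ℂ} (hF : IsClosed F)
    (𝔽 : Filtration ℝ (inferInstance : MeasurableSpace C(unitInterval, ℂ)))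
    (h𝔽 : ∀ t : ℝ,
      𝔽 t = MeasurableSpace.comap (fun ω : C(unitInterval, ℂ) => stp[t, ω]) inferInstance)
    (m : ℕ) : IsStoppingTime 𝔽 fun ω => (((⌈hit[F, ω] * 2 ^ m⌉ : ℝ) / 2 ^ m : ℝ) : WithTop ℝ) := by
  intro t
  have hset : {ω : C(unitInterval, ℂ) | (((⌈hit[F, ω] * 2 ^ m⌉ : ℝ) / 2 ^ m : ℝ) : WithTop ℝ) ≤ t} =
      {ω | ((hit[F, ω] : ℝ) : WithTop ℝ) ≤ ((⌊t * 2 ^ m⌋ : ℝ) / 2 ^ m : ℝ)} := by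
    ext ω; simp only [Set.mem_setOf_eq, WithTop.coe_le_coe, ceil_div_le_iff]
  rw [hset]
  exact 𝔽.mono (by rw [div_le_iff₀ (by positivity)]; exact Int.floor_le _) _
    (isStoppingTime_hit hF 𝔽 h𝔽 _)

/-- The dyadic upper approximation of the hitting parameter is a Borel function of the path.
[folklore] -/
theorem measurable_ceil_hit {F : Set ℂ} (hF : IsClosed F) (m : ℕ) :
    Measurable fun ω : C(unitInterval, ℂ) => (⌈hit[F, ω] * 2 ^ m⌉ : ℝ) / 2 ^ m :=
  ((measurable_of_countable (fun z : ℤ => (z : ℝ))).comp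
    ((Curve.measurable_hitParam_mk hF).mul_const _).ceil).div_const _

/-- **Choice of the dyadic levels** by continuity from above: for each `k` the sets
`{τ_k < τ_F ≤ τ_k + 2^{-n}}` (`τ_k` the hitting parameter of `cthickening (1/(k+1)) F`) decrease
to `∅` as `n → ∞`. [folklore] -/
theorem exists_levels {F : Set ℂ} (hF : IsClosed F) (μ : Measure C(unitInterval, ℂ))
    [IsFiniteMeasure μ] {ε : ℝ} (hε : 0 < ε) :
    ∃ m : ℕ → ℕ, ∀ k : ℕ, μ {ω | hit[cthickening (1 / ((k:ℝ) + 1)) F, ω] < hit[F, ω] ∧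
      hit[F, ω] ≤ hit[cthickening (1 / ((k:ℝ) + 1)) F, ω] + 1 / 2 ^ (m k)} ≤
      ENNReal.ofReal (ε / 2 / 2 ^ k) := by
  suffices h : ∀ k : ℕ, ∃ n : ℕ, μ {ω | hit[cthickening (1 / ((k:ℝ) + 1)) F, ω] < hit[F, ω] ∧
      hit[F, ω] ≤ hit[cthickening (1 / ((k:ℝ) + 1)) F, ω] + 1 / 2 ^ n} ≤
      ENNReal.ofReal (ε / 2 / 2 ^ k) by
    choose m hm using h
    exact ⟨m, hm⟩
  intro k
  set G := cthickening (1 / ((k:ℝ) + 1)) F with hG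
  set A : ℕ → Set C(unitInterval, ℂ) := fun n => {ω | hit[G, ω] < hit[F, ω] ∧
    hit[F, ω] ≤ hit[G, ω] + 1 / 2 ^ n} with hA
  have hGm : Measurable fun ω : C(unitInterval, ℂ) => hit[G, ω] :=
    Curve.measurable_hitParam_mk isClosed_cthickening
  have hFm : Measurable fun ω : C(unitInterval, ℂ) => hit[F, ω] := Curve.measurable_hitParam_mk hF
  have hmeas : ∀ n, MeasurableSet (A n) := fun n =>
    (measurableSet_lt hGm hFm).inter (measurableSet_le hFm (hGm.add_const _))
  have hanti : Antitone A := by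
    intro n n' hnn' ω hω
    refine ⟨hω.1, hω.2.trans (add_le_add le_rfl ?_)⟩
    exact one_div_le_one_div_of_le (by positivity) (pow_le_pow_right₀ one_le_two hnn')
  have hempty : ⋂ n, A n = ∅ := Set.eq_empty_of_forall_notMem fun ω hω => by
    simp only [Set.mem_iInter, hA, Set.mem_setOf_eq] at hω
    have h2 : Tendsto (fun n : ℕ => hit[G, ω] + 1 / (2:ℝ) ^ n) atTop (𝓝 (hit[G, ω] + 0)) :=
      tendsto_const_nhds.add
        (tendsto_const_nhds.div_atTop (tendsto_pow_atTop_atTop_of_one_lt one_lt_two))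
    rw [add_zero] at h2
    exact absurd (ge_of_tendsto' h2 fun n => (hω n).2) (not_le.2 (hω 0).1)
  have htend : Tendsto (μ ∘ A) atTop (𝓝 0) := by
    have := tendsto_measure_iInter_atTop (μ := μ) (fun n => (hmeas n).nullMeasurableSet) hanti
      ⟨0, measure_ne_top μ _⟩
    rwa [hempty, measure_empty] at this
  obtain ⟨n, hn⟩ := ((tendsto_order.1 htend).2 _
    (ENNReal.ofReal_pos.2 (by positivity : (0:ℝ) < ε / 2 / 2 ^ k))).exists
  exact ⟨n, hn.le⟩

end Measurable

/-- **Soft-Markov brick P1a (registered stub `stub_announcingOnPathSpace`).** On the path space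
`C([0,1], ℂ)` with the canonical filtration, for a closed `F`, a finite measure `μ` and `ε > 0`
there are rational-valued increasing stopping times `σ n ≤ 1` and an event `B` (the running
maxima of dyadic upper approximations of the hitting parameters of the closed thickenings of `F`,
and the event where all of them are `< τ_F`) such that: on `B`, `σ n < τ_F` and `σ n → τ_F`;
`B` is measurable for `σ(path stopped at τ_F)` and for `⨆ n, 𝔽_{σ n}`; each `σ n` is a Borel
function of the path stopped at `τ_F`; and `μ ({start ∉ F, meets F} \ B) ≤ ε`. [folklore] -/
theorem stub_announcingOnPathSpace : ∀ [MeasurableSpace C(unitInterval, ℂ)] [BorelSpace C(unitInterval, ℂ)] (𝔽 : MeasureTheory.Filtration ℝ (inferInstance : MeasurableSpace C(unitInterval, ℂ))), (∀ t : ℝ, 𝔽 t = MeasurableSpace.comap (fun ω : C(unitInterval, ℂ) => ((ω).comp (ContinuousMap.id unitInterval ⊓ ContinuousMap.const unitInterval (Set.projIcc (0:ℝ) 1 zero_le_one (t))))) inferInstance) → ∀ (μ : MeasureTheory.Measure C(unitInterval, ℂ)) [MeasureTheory.IsFiniteMeasure μ] (F : Set ℂ), IsClosed F → ∀ ε : ℝ,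 0 < ε → ∃ (σ : ℕ → C(unitInterval, ℂ) → ℝ) (B : Set C(unitInterval, ℂ)) (hσ : ∀ n, MeasureTheory.IsStoppingTime 𝔽 (fun ω => ((σ n ω : ℝ) : WithTop ℝ))), (∀ n ω, σ n ω ∈ Set.range (fun q : ℚ => (q : ℝ))) ∧ (∀ n ω, σ n ω ≤ σ (n + 1) ω) ∧ (∀ n ω, σ n ω ≤ 1) ∧ (∀ ω ∈ B, ∀ n, σ n ω < ((Literature.Probability.RandomPlanarGeometry.Curve.mk (ω)).hitParam F)) ∧ (∀ ω ∈ B, Filter.Tendsto (fun n => σ n ω) Filter.atTop (nhds ((Literature.Probability.RandomPlanarGeometry.Curve.mk (ω)).hitParam F))) ∧ @MeasurableSet C(unitInterval, ℂ) (MeasurableSpace.comap (fun ω : C(unitInterval, ℂ) => ((ω).comp (ContinuousMap.id unitInterval ⊓ ContinuousMap.const unitInterval (Set.projIcc (0:ℝ) 1 zero_le_one (((Literature.Probability.RandomPlanarGeometry.Curve.mk (ω)).hitParam F)))))) inferInstance) B ∧ @MeasurableSet C(unitInterval, ℂ) (⨆ n, (hσ n).measurableSpace) B ∧ (∀ n,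 ∃ g : C(unitInterval, ℂ) → ℝ, Measurable g ∧ ∀ ω, σ n ω = g ((ω).comp (ContinuousMap.id unitInterval ⊓ ContinuousMap.const unitInterval (Set.projIcc (0:ℝ) 1 zero_le_one (((Literature.Probability.RandomPlanarGeometry.Curve.mk (ω)).hitParam F)))))) ∧ μ ({ω : C(unitInterval, ℂ) | ω 0 ∉ F ∧ ∃ t, ω t ∈ F} \ B) ≤ ENNReal.ofReal ε := by
  intro _ _ 𝔽 h𝔽 μ _ F hF ε hε
  -- levels `m k` and the dyadic upper approximations `ρ k` of the thickening hitting parameters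
  obtain ⟨m, hm⟩ := exists_levels hF μ hε
  have hcl : ∀ k : ℕ, IsClosed (cthickening (1 / ((k:ℝ) + 1)) F) := fun k => isClosed_cthickening
  obtain ⟨ρ, hρ⟩ : ∃ ρ : ℕ → C(unitInterval, ℂ) → ℝ, ∀ k, ρ k = fun ω =>
      (⌈hit[cthickening (1 / ((k:ℝ) + 1)) F, ω] * 2 ^ (m k)⌉ : ℝ) / 2 ^ (m k) := ⟨_, fun _ => rfl⟩
  have hρ1 : ∀ (k : ℕ) ω, hit[cthickening (1 / ((k:ℝ) + 1)) F, ω] ≤ ρ k ω := fun k ω => by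
    rw [hρ]; exact le_ceil_div _ _
  have hρ2 : ∀ (k : ℕ) ω, ρ k ω ≤ hit[cthickening (1 / ((k:ℝ) + 1)) F, ω] + 1 / 2 ^ (m k) :=
    fun k ω => by rw [hρ]; exact ceil_div_le_add _ _
  have hρ3 : ∀ k ω, ρ k ω ≤ 1 := fun k ω => by
    rw [hρ]; exact ceil_div_le_one (Curve.hitParam_mem_Icc _ _).2 _
  have hρq : ∀ k ω, ρ k ω ∈ Set.range (fun q : ℚ => (q : ℝ)) := fun k ω => by
    rw [hρ]; exact ceil_div_mem_range _ _
  have hρst : ∀ k, IsStoppingTime 𝔽 fun ω => ((ρ k ω : ℝ) : WithTop ℝ) := fun k => by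
    rw [hρ]; exact isStoppingTime_ceil_hit (hcl k) 𝔽 h𝔽 (m k)
  have hρm : ∀ k, Measurable (ρ k) := fun k => by rw [hρ]; exact measurable_ceil_hit (hcl k) _
  have hρc : ∀ k, (Set.range (ρ k)).Countable := fun k => by
    rw [hρ]
    exact (Set.countable_range fun z : ℤ => (z : ℝ) / 2 ^ (m k)).mono
      (by rintro _ ⟨ω, rfl⟩; exact ⟨_, rfl⟩)
  have hρinv : ∀ k ω, ρ k (stp[hit[F, ω], ω]) = ρ k ω := fun k ω => by
    simp only [hρ, hit_stp_hit (hcl k) (self_subset_cthickening F)]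
  have hFst := isStoppingTime_hit hF 𝔽 h𝔽
  -- the announcing sequence `σ n = max_{k ≤ n} ρ k` and the good event `B`
  obtain ⟨σ, hσ0, hσs⟩ : ∃ σ : ℕ → C(unitInterval, ℂ) → ℝ, (∀ ω, σ 0 ω = ρ 0 ω) ∧
      ∀ n ω, σ (n + 1) ω = max (σ n ω) (ρ (n + 1) ω) :=
    ⟨fun n => Nat.rec (motive := fun _ => C(unitInterval, ℂ) → ℝ) (ρ 0)
      (fun k s ω => max (s ω) (ρ (k + 1) ω)) n, fun _ => rfl, fun _ _ => rfl⟩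
  have hσst : ∀ n, IsStoppingTime 𝔽 fun ω => ((σ n ω : ℝ) : WithTop ℝ) := by
    intro n
    induction n with
    | zero => simp_rw [hσ0]; exact hρst 0
    | succ n ih =>
      have := ih.max (hρst (n + 1))
      simp_rw [hσs, WithTop.coe_max]
      exact this
  have hρσ : ∀ n ω, ρ n ω ≤ σ n ω := by
    intro n ω
    cases n with
    | zero => rw [hσ0]
    | succ n => rw [hσs]; exact le_max_right _ _
  have hσm : ∀ n, Measurable (σ n) := by
    intro n
    induction n with
    | zero => rw [show σ 0 = ρ 0 from funext hσ0]; exact hρm 0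
    | succ n ih =>
      rw [show σ (n + 1) = fun ω => max (σ n ω) (ρ (n + 1) ω) from funext (hσs n)]
      exact ih.max (hρm _)
  have hσinv : ∀ n ω, σ n (stp[hit[F, ω], ω]) = σ n ω := by
    intro n ω
    induction n with
    | zero => rw [hσ0, hσ0, hρinv]
    | succ n ih => rw [hσs, hσs, ih, hρinv]
  set B : Set C(unitInterval, ℂ) := ⋂ k, {ω | ρ k ω < hit[F, ω]} with hB
  have hσlt : ∀ ω ∈ B, ∀ n, σ n ω < hit[F, ω] := by
    intro ω hω n
    have hω' : ∀ k, ρ k ω < hit[F, ω] := by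
      simpa only [hB, Set.mem_iInter, Set.mem_setOf_eq] using hω
    induction n with
    | zero => rw [hσ0]; exact hω' 0
    | succ n ih => rw [hσs]; exact max_lt ih (hω' _)
  have hB𝒢 : MeasurableSet[⨆ n, (hσst n).measurableSpace] B := by
    refine MeasurableSet.iInter fun k => ?_
    exact le_iSup (fun n => (hσst n).measurableSpace) k _
      ((hρst k).measurableSpace_mono (hσst k) (fun ω => WithTop.coe_le_coe.2 (hρσ k ω)) _
        (measurableSet_lt_stoppingTime (hρst k) (hρc k) hFst))
  have hBℋ : MeasurableSet[MeasurableSpace.comap (fun ω : C(unitInterval, ℂ) => stp[hit[F, ω], ω])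
      inferInstance] B := by
    rw [MeasurableSpace.measurableSet_comap]
    refine ⟨B, MeasurableSet.iInter fun k => measurableSet_lt (hρm k)
      (Curve.measurable_hitParam_mk hF), ?_⟩
    ext ω
    simp only [hB, Set.mem_preimage, Set.mem_iInter, Set.mem_setOf_eq, hρinv,
      hit_stp_hit hF Subset.rfl]
  -- the measure bound
  have hsub : {ω : C(unitInterval, ℂ) | ω 0 ∉ F ∧ ∃ t, ω t ∈ F} \ B ⊆
      ⋃ k : ℕ, {ω | hit[cthickening (1 / ((k:ℝ) + 1)) F, ω] < hit[F, ω] ∧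
        hit[F, ω] ≤ hit[cthickening (1 / ((k:ℝ) + 1)) F, ω] + 1 / 2 ^ (m k)} := by
    rintro ω ⟨⟨h0, hh⟩, hωB⟩
    simp only [hB, Set.mem_iInter, Set.mem_setOf_eq, not_forall, not_lt] at hωB
    obtain ⟨k, hk⟩ := hωB
    exact Set.mem_iUnion.2 ⟨k, hit_cthickening_lt hF (by positivity) h0 hh, hk.trans (hρ2 k ω)⟩
  refine ⟨σ, B, hσst, ?_, fun n ω => ?_, ?_, hσlt, fun ω hω => ?_, hBℋ, hB𝒢,
    fun n => ⟨σ n, hσm n, fun ω => (hσinv n ω).symm⟩, ?_⟩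
  · intro n ω
    induction n with
    | zero => rw [hσ0]; exact hρq 0 ω
    | succ n ih =>
      obtain ⟨a, ha⟩ := ih
      obtain ⟨b, hb⟩ := hρq (n + 1) ω
      refine ⟨max a b, ?_⟩
      show ((max a b : ℚ) : ℝ) = σ (n + 1) ω
      rw [Rat.cast_max, hσs]
      exact congrArg₂ max ha hb
  · rw [hσs]; exact le_max_left _ _
  · intro n ω
    induction n with
    | zero => rw [hσ0]; exact hρ3 0 ω
    | succ n ih => rw [hσs]; exact max_le ih (hρ3 _ ω)
  · exact tendsto_of_tendsto_of_tendsto_of_le_of_le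
      (Curve.tendsto_hitParam_cthickening hF (Curve.mk ω)) tendsto_const_nhds
      (fun n => (hρ1 n ω).trans (hρσ n ω)) fun n => (hσlt ω hω n).le
  · calc μ ({ω : C(unitInterval, ℂ) | ω 0 ∉ F ∧ ∃ t, ω t ∈ F} \ B)
          ≤ μ (⋃ k : ℕ, {ω | hit[cthickening (1 / ((k:ℝ) + 1)) F, ω] < hit[F, ω] ∧
            hit[F, ω] ≤ hit[cthickening (1 / ((k:ℝ) + 1)) F, ω] + 1 / 2 ^ (m k)}) :=
          measure_mono hsub
      _ ≤ ∑' k : ℕ, μ {ω | hit[cthickening (1 / ((k:ℝ) + 1)) F, ω] < hit[F, ω] ∧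
            hit[F, ω] ≤ hit[cthickening (1 / ((k:ℝ) + 1)) F, ω] + 1 / 2 ^ (m k)} :=
          measure_iUnion_le _
      _ ≤ ∑' k, ENNReal.ofReal (ε / 2 / 2 ^ k) := ENNReal.tsum_le_tsum hm
      _ = ENNReal.ofReal ε := by
          rw [← ENNReal.ofReal_tsum_of_nonneg (fun k => by positivity) (summable_geometric_two' ε),
            tsum_geometric_two']


end Summit.CriticalPhenomena.SAWScalingLimit.Theorems.AxiomsOfLimitMarkov

end
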